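import Mathlib.Analysis.InnerProductSpace.Basic
import Mathlib.Analysis.InnerProductSpace.PiL2
import Mathlib.Analysis.Normed.Operator.Bilinear
import Mathlib.Analysis.Normed.Operator.BoundedLinearMaps
import Mathlib.Topology.MetricSpace.ProperSpace
import Literature.Geometry.Lorentzian.Basic
import HarnessLib

/-!
# Crux `GapExhaustion` (stmt-FinalStateConjecture-10808), line `photon-shell-pseudoconvexity`:
# stub (F-2) `stub_conditionalMarginMultiplier` — multiplier/penalty form of a margin on a
# doubly linearly constrained null cone

Route `BartnikGapSettling`; helper (`--supports stmt-FinalStateConjecture-10808`) landing the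
registered sub-stub (F-2) of line lead c7. The Ionescu–Klainerman Carleman estimate across the
Kerr cylinders (Invent. Math. 175 (2009), Def. 3.1; Alexakis–Ionescu–Klainerman, CMP 299 (2010),
Lemma 4.3) consumes the `T`-conditional pseudo-convexity of `r` in MULTIPLIER form
`ε₁²|X|² ≤ X·X(μ g − D²r) + ε⁻²(|g(T,X)|² + |dr(X)|²)` for ALL vectors `X`, whereas the geometry
gives a margin `Hess r (w, w) ≤ −m‖w‖²` only on the constrained cone `{g(w,w) = 0, dr(w) = 0,
g(T,w) = 0}`. This file is the linear-algebra step from the latter to the former, GIVEN Finsler's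
lemma with margin (stub (F-1), the hypothesis of the implication): a Lagrange multiplier `μ` for
the quadratic constraint and a penalty constant `C` for the two linear ones.

Proof: restrict the two forms to the subspace `W = ker ℓ₁ ⊓ ker ℓ₂` (a finite-dimensional real
inner product space in `Type`) and apply (F-1) there, getting `μ, c` with
`q x x − μ g x x ≤ −c‖x‖²` on `W`; then a directed-open-cover compactness argument on the unit
sphere of `E4` gives `n : ℕ` with `q x x − μ g x x − n (ℓ₁ x² + ℓ₂ x²) < −c/2` on the sphere
(the sets `{· < −c/2}` increase with `n` and cover the sphere: a unit vector with
`ℓ₁ x = ℓ₂ x = 0` lies in `W`, any other has `ℓ₁ x² + ℓ₂ x² > 0`); `2`-homogeneity finishes.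
Mathlib only.
-/

noncomputable section

-- D-0017: single-problem summit, `Summit.<S>.<S>.…` by design
-- (cf. lakefile `weak.linter.dupNamespace`).
set_option linter.dupNamespace false

namespace Summit.FinalStateConjecture.FinalStateConjecture.Theorems

open Set
open Literature.Geometry.Lorentzian

/-- Homogeneity reduction: a degree-`2` homogeneous real function on `E4` that is nonpositive on
the unit sphere is nonpositive everywhere. [folklore] -/
private theorem conditionalMarginMultiplier_nonpos_of_sphere (Φ : E4 → ℝ)
    (hΦ : ∀ (r : ℝ) (x : E4), Φ (r • x) = r ^ 2 * Φ x)
    (h : ∀ u ∈ Metric.sphere (0 : E4) 1, Φ u ≤ 0) : ∀ x : E4, Φ x ≤ 0 := by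
  intro x
  by_cases hx : x = 0
  · have h0 := hΦ 0 0
    rw [zero_smul] at h0
    rw [hx, h0]
    simp
  · have hr : 0 < ‖x‖ := norm_pos_iff.2 hx
    have hu : ‖x‖⁻¹ • x ∈ Metric.sphere (0 : E4) 1 := by
      rw [mem_sphere_zero_iff_norm, norm_smul, norm_inv, norm_norm, inv_mul_cancel₀ hr.ne']
    have hxu : x = ‖x‖ • (‖x‖⁻¹ • x) := by
      rw [smul_smul, mul_inv_cancel₀ hr.ne', one_smul]
    rw [hxu, hΦ]
    exact mul_nonpos_of_nonneg_of_nonpos (sq_nonneg _) (h _ hu)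

/-- Restriction step: Finsler's lemma with margin (F-1), applied on the subspace
`W = ker ℓ₁ ⊓ ker ℓ₂` of `E4`, turns a margin on the constrained null cone
`{g x x = 0, ℓ₁ x = 0, ℓ₂ x = 0}` into a multiplier estimate on all of `W`. [folklore] -/
private theorem conditionalMarginMultiplier_restrict
    (hF : ∀ (V : Type) [NormedAddCommGroup V] [InnerProductSpace ℝ V] [FiniteDimensional ℝ V]
      (q g : V →L[ℝ] V →L[ℝ] ℝ) (m : ℝ), 0 < m →
      (∀ x : V, g x x = 0 → q x x ≤ -m * ‖x‖ ^ 2) →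
      ∃ (μ c : ℝ), 0 < c ∧ ∀ x : V, q x x - μ * g x x ≤ -c * ‖x‖ ^ 2)
    (q g : E4 →L[ℝ] E4 →L[ℝ] ℝ) (ℓ₁ ℓ₂ : E4 →L[ℝ] ℝ) (m : ℝ) (hm : 0 < m)
    (hq : ∀ x : E4, g x x = 0 → ℓ₁ x = 0 → ℓ₂ x = 0 → q x x ≤ -m * ‖x‖ ^ 2) :
    ∃ (μ c : ℝ), 0 < c ∧
      ∀ x : E4, ℓ₁ x = 0 → ℓ₂ x = 0 → q x x - μ * g x x ≤ -c * ‖x‖ ^ 2 := by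
  let W : Submodule ℝ E4 := ℓ₁.ker ⊓ ℓ₂.ker
  have hWq : ∀ y : W, (g.bilinearComp W.subtypeL W.subtypeL) y y = 0 →
      (q.bilinearComp W.subtypeL W.subtypeL) y y ≤ -m * ‖y‖ ^ 2 := by
    intro y hgy
    simp only [ContinuousLinearMap.bilinearComp_apply, Submodule.subtypeL_apply] at hgy ⊢
    rw [Submodule.coe_norm]
    have hy := Submodule.mem_inf.1 y.2
    exact hq (y : E4) hgy (LinearMap.mem_ker.1 hy.1) (LinearMap.mem_ker.1 hy.2)
  obtain ⟨μ, c, hc, h⟩ := hF W (q.bilinearComp W.subtypeL W.subtypeL)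
    (g.bilinearComp W.subtypeL W.subtypeL) m hm hWq
  refine ⟨μ, c, hc, fun x h1 h2 => ?_⟩
  have hx : x ∈ W := Submodule.mem_inf.2 ⟨LinearMap.mem_ker.2 h1, LinearMap.mem_ker.2 h2⟩
  have := h ⟨x, hx⟩
  simpa only [ContinuousLinearMap.bilinearComp_apply, Submodule.subtypeL_apply,
    Submodule.coe_norm] using this

/-- (F-2) The multiplier/penalty form of a margin on a doubly linearly constrained null cone.
Assume Finsler's lemma with margin (F-1) on every finite-dimensional real inner product space.
Let `q, g` be continuous bilinear forms and `ℓ₁, ℓ₂` continuous linear forms on `E4`, and suppose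
`q x x ≤ -m‖x‖²` (`m > 0`) whenever `g x x = 0`, `ℓ₁ x = 0` and `ℓ₂ x = 0`. Then there are a
multiplier `μ`, a penalty constant `C` and a margin `c > 0` with
`q x x - μ g x x - C (ℓ₁ x ^ 2 + ℓ₂ x ^ 2) ≤ -c‖x‖²` for ALL `x : E4` (the form consumed by the
Ionescu–Klainerman Carleman estimate, Invent. Math. 175 (2009), Def. 3.1;
Alexakis–Ionescu–Klainerman, CMP 299 (2010), Lemma 4.3, with `q ↦ Hess r`, `g ↦` the metric,
`ℓ₁ ↦ dr`, `ℓ₂ ↦ g(T, ·)`). [folklore] -/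
theorem stub_conditionalMarginMultiplier :
    (∀ (V : Type) [NormedAddCommGroup V] [InnerProductSpace ℝ V] [FiniteDimensional ℝ V]
      (q g : V →L[ℝ] V →L[ℝ] ℝ) (m : ℝ), 0 < m →
      (∀ x : V, g x x = 0 → q x x ≤ -m * ‖x‖ ^ 2) →
      ∃ (μ c : ℝ), 0 < c ∧ ∀ x : V, q x x - μ * g x x ≤ -c * ‖x‖ ^ 2) →
    ∀ (q g : E4 →L[ℝ] E4 →L[ℝ] ℝ) (ℓ₁ ℓ₂ : E4 →L[ℝ] ℝ) (m : ℝ), 0 < m →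
      (∀ x : E4, g x x = 0 → ℓ₁ x = 0 → ℓ₂ x = 0 → q x x ≤ -m * ‖x‖ ^ 2) →
      ∃ (μ C c : ℝ), 0 < c ∧ ∀ x : E4,
        q x x - μ * g x x - C * ((ℓ₁ x) ^ 2 + (ℓ₂ x) ^ 2) ≤ -c * ‖x‖ ^ 2 := by
  intro hF q g ℓ₁ ℓ₂ m hm hq
  -- Step 1: multiplier on `W = ker ℓ₁ ⊓ ker ℓ₂` from Finsler's lemma (F-1).
  obtain ⟨μ, c, hc, hW⟩ := conditionalMarginMultiplier_restrict hF q g ℓ₁ ℓ₂ m hm hq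
  -- Step 2: penalty constant by compactness of the unit sphere (directed open cover).
  have hPc : Continuous fun x : E4 => q x x - μ * g x x := by fun_prop
  have hLc : Continuous fun x : E4 => (ℓ₁ x) ^ 2 + (ℓ₂ x) ^ 2 := by fun_prop
  obtain ⟨n, hn⟩ : ∃ n : ℕ, Metric.sphere (0 : E4) 1 ⊆
      {x | q x x - μ * g x x - (n : ℝ) * ((ℓ₁ x) ^ 2 + (ℓ₂ x) ^ 2) < -(c / 2)} := by
    refine (isCompact_sphere (0 : E4) 1).elim_directed_cover
      (fun n : ℕ => {x | q x x - μ * g x x - (n : ℝ) * ((ℓ₁ x) ^ 2 + (ℓ₂ x) ^ 2) < -(c / 2)})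
      (fun n => isOpen_lt (hPc.sub (continuous_const.mul hLc)) continuous_const) ?_ ?_
    · intro x hx
      rw [mem_sphere_zero_iff_norm] at hx
      simp only [mem_iUnion, mem_setOf_eq]
      by_cases hLx : (ℓ₁ x) ^ 2 + (ℓ₂ x) ^ 2 = 0
      · have h1 : ℓ₁ x = 0 := by nlinarith [sq_nonneg (ℓ₁ x), sq_nonneg (ℓ₂ x)]
        have h2 : ℓ₂ x = 0 := by nlinarith [sq_nonneg (ℓ₁ x), sq_nonneg (ℓ₂ x)]
        refine ⟨0, ?_⟩
        have := hW x h1 h2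
        rw [hx] at this
        rw [hLx]
        push_cast
        linarith
      · have hLpos : 0 < (ℓ₁ x) ^ 2 + (ℓ₂ x) ^ 2 := lt_of_le_of_ne (by positivity) (Ne.symm hLx)
        obtain ⟨n, hn⟩ := exists_nat_gt ((q x x - μ * g x x + c / 2) / ((ℓ₁ x) ^ 2 + (ℓ₂ x) ^ 2))
        refine ⟨n, ?_⟩
        rw [div_lt_iff₀ hLpos] at hn
        linarith
    · refine Monotone.directed_le fun a b hab x hxa => ?_
      simp only [mem_setOf_eq] at hxa ⊢
      have hab' : (a : ℝ) ≤ b := by exact_mod_cast hab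
      nlinarith [sq_nonneg (ℓ₁ x), sq_nonneg (ℓ₂ x)]
  -- Step 3: homogeneity.
  refine ⟨μ, n, c / 2, half_pos hc, fun x => ?_⟩
  have key := conditionalMarginMultiplier_nonpos_of_sphere
    (fun x => q x x - μ * g x x - (n : ℝ) * ((ℓ₁ x) ^ 2 + (ℓ₂ x) ^ 2) + c / 2 * ‖x‖ ^ 2)
    ?_ ?_ x
  · linarith
  · intro r y
    simp only [map_smul, smul_apply, smul_eq_mul, norm_smul,
      Real.norm_eq_abs, mul_pow, sq_abs]
    ring
  · intro u hu
    have h1 : ‖u‖ = 1 := mem_sphere_zero_iff_norm.1 hu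
    have := hn hu
    simp only [mem_setOf_eq] at this
    rw [h1]
    linarith

end Summit.FinalStateConjecture.FinalStateConjecture.Theorems

end
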